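import Summits.CriticalPhenomena.PercolationContinuityZ3.Theorems.PercNearOneGluingNoHeavyQuantBlockCombStaircaseRow
import Summits.CriticalPhenomena.PercolationContinuityZ3.Theorems.PercNearOneGluingNoHeavyQuantBlockCombRow
import HarnessLib

/-!
# QUANT lane R8, FAR on trees: the block-comb row in crossing form HOLDS (`Quant.BlockComb.le_crossing_of_mean`), so the typer's
# transports of `…QuantBlockCombStaircaseRow.lean` become UNCONDITIONAL — FAR for every block-comb in `Quant.FarTreeRow`'s own
# vocabulary (ancestor finsets + comb condition) and in the route vocabulary

builds on p205010 (kernel theorem, internal audit signed; external expert review pending)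

Support file (`--supports stmt-CriticalPhenomena-4575`), QUANT lane lead (gen 14); memo `run/shared/lean/prim/quant/prim-quant-lead-g14/LEAD-NOTES-G14.md`
(README V170/V176).  Theorems only, no definitions, no sorries, standard axioms.

The typer (stmt g15, p248095 `…QuantBlockCombStaircaseRow.lean`) carried the budget-binding block-comb row as an explicit HYPOTHESIS `hS` (crossing
form of the canonical model) and asked for it to be typed as `@[conjecture] def Quant.BlockComb.StaircaseRow`.  It is no longer a conjecture: the
canonical row is a kernel theorem twice (census-1 g13 p247138 `Quant.BlockComb.tail_ge_of_mean`; p1 g9 p247206 `Quant.BlockComb.tail_ge_of_le_marg_of_mean`,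
Markov on the deficit + the half-class merge induction).  This file discharges `hS`:

* `Quant.BlockComb.le_crossing_of_mean` — **the row in crossing form**: blobs `0, …, M−1` with sizes `sz k`, private gates `p k ∈ [0,1]`, chain gates
  `qc i ∈ [0,1]` (chain weight `W k = ∏_{i<k+1} qc i`, an arbitrary non-increasing staircase); if `x ≤ W k·p k` for every live `k` and
  `2j < Σ_{k<M} sz k·W k·p k`, then `x ≤ Σ_{k<M} W k·p k·(CB[sz,p,k] j − CB[sz,p,k](j − sz k))` (`= P(N ≥ j+1)`, `Quant.BlockComb.tail_eq_crossing`).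
  Proof: `tail_ge_of_le_marg_of_mean` on the index type `Fin M` with blob `k` at level `k+1`, rewritten by `tail_eq_crossing` — the pattern of
  `le_crossing_of_class`.
* `Quant.farTree_blockComb_comb`, `Quant.farTree_blockComb_comb_essential` — **`Quant.FarTreeRow`'s conclusion for EVERY block-comb** (ancestor finsets
  with the forest axioms, relays `A ∋ a` with `a` least likely, comb condition `P b ≠ P b' → P b ∩ P b' ⊆ P a` on `A` — resp. on the essential ancestor
  sets — mean `2j < Σ_{b∈A} ∏_{P b} q`, cut `1 − ∏_{P a} q ≤ t` ⟹ `P(#{b ∈ A : ↑(P b) ⊆ ω} ≤ j) ≤ t`): `farTree_blockComb_of_staircaseRow(_essential)`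
  with `hS` discharged.
* `Quant.farRelayRow_tree_blockComb_comb` — the same in the ROUTE vocabulary (`o ∉ A`, tree-supported weights on `Sym2 (Fin n)`, essential
  ancestor sets combed around the least likely relay): `farRelayRow_tree_blockComb_of_staircaseRow` with `hS` discharged.  (p1 g9's
  `Quant.farRelayRow_tree_blockComb` (p247247) and census-1's `farRelayRow_tree_blockComb_of_mean` state the same row through an explicit block-comb
  presentation; this is the comb-condition presentation the `FarTreeRow` bookkeeping uses.)
[cite: KozmaNitzan2024, Conjecture 3 (p. 15)] (the gluing rows served); [this work].
-/

noncomputable section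

namespace Summit.CriticalPhenomena.PercolationContinuityZ3.Theorems

namespace Quant

open Finset MeasureTheory
open Literature.Probability.LatticeModels
open Literature.Probability.Percolation
open scoped Classical

namespace BlockComb

variable {κ : Type*} [Fintype κ] [DecidableEq κ]

/-- product-Bernoulli weight of the set `S` of open blob gates -/
local notation3 "wt[" g ", " S "]" => ∏ k, (if k ∈ (S : Finset κ) then (g : κ → ℝ) k else 1 - (g : κ → ℝ) k)

/-- probability that the chain `q` of length `D` is open exactly to depth `i` -/
local notation3 "pd[" D ", " q ", " i "]" =>
  (∏ i' ∈ Finset.range (i : ℕ), (q : ℕ → ℝ) i') * (if (i : ℕ) < (D : ℕ) then 1 - (q : ℕ → ℝ) i else 1)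

/-- mass counted at depth `i` in blob configuration `S` -/
local notation3 "mass[" lv ", " a ", " i ", " S "]" =>
  ∑ k ∈ (S : Finset κ).filter (fun k => (lv : κ → ℕ) k ≤ (i : ℕ)), ((a : κ → ℕ) k : ℕ)

/-- the tail `P(N ≥ j+1)` of the block-comb count, as an explicit finite sum -/
local notation3 "TAIL[" D ", " q ", " lv ", " a ", " g ", " j "]" =>
  ∑ i ∈ Finset.range ((D : ℕ) + 1), pd[D, q, i] *
    ∑ S : Finset κ, wt[g, S] * (if (j : ℕ) + 1 ≤ mass[lv, a, i, S] then (1 : ℝ) else 0)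

/-- `CB[a, p, m] t` = probability that the open mass of the first `m` blobs (sizes `a`, gates `p`) is `≤ t` (the recursion of
`…QuantBlobWalk.lean`, verbatim). -/
local notation3 "CB[" a ", " p ", " m "]" =>
  (Nat.rec (motive := fun _ => ℤ → ℝ) (fun t => if (0 : ℤ) ≤ t then (1 : ℝ) else 0)
    (fun n f t => (p : ℕ → ℝ) n * f (t - ((a : ℕ → ℕ) n : ℤ)) + (1 - (p : ℕ → ℝ) n) * f t) (m : ℕ))

omit [Fintype κ] [DecidableEq κ] in
/-- **The block-comb row in crossing form** (`Quant.BlockComb.tail_ge_of_le_marg_of_mean` ∘ `tail_eq_crossing`).  Blobs `0, …, M−1` with sizes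
`sz k`, private gates `p k ∈ [0,1]`, blob `k` hanging at the `k+1`-st of `M` chain gates `qc i ∈ [0,1]` (chain weight `W k = ∏_{i<k+1} qc i`):
if `x ≤ W k · p k` for every live `k` (`sz k > 0`) and `2j < Σ_{k<M} sz k · W k · p k`, then
`x ≤ Σ_{k<M} W k · p k · (CB[sz,p,k] j − CB[sz,p,k](j − sz k))`.  This is exactly the hypothesis `hS` of
`Quant.farTree_blockComb_of_staircaseRow` (the body the typer wanted typed as `Quant.BlockComb.StaircaseRow`). [this work] -/
theorem le_crossing_of_mean (M : ℕ) (qc : ℕ → ℝ) (sz : ℕ → ℕ) (p : ℕ → ℝ) (j : ℕ) (x : ℝ)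
    (hqc : ∀ i, 0 ≤ qc i ∧ qc i ≤ 1) (hp : ∀ k, 0 ≤ p k ∧ p k ≤ 1)
    (hx : ∀ k, k < M → 0 < sz k → x ≤ (∏ i ∈ Finset.range (k + 1), qc i) * p k)
    (hmean : (2 * j : ℝ) < ∑ k ∈ Finset.range M, (sz k : ℝ) * ((∏ i ∈ Finset.range (k + 1), qc i) * p k)) :
    x ≤ ∑ k ∈ Finset.range M, (∏ i ∈ Finset.range (k + 1), qc i) * p k *
        (CB[sz, p, k] (j : ℤ) - CB[sz, p, k] ((j : ℤ) - (sz k : ℤ))) := by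
  have hsum : (∑ k' : Fin M, ((sz k'.val : ℕ) : ℝ) * ((∏ i ∈ Finset.range (k'.val + 1), qc i) * p k'.val)) =
      ∑ k ∈ Finset.range M, (sz k : ℝ) * ((∏ i ∈ Finset.range (k + 1), qc i) * p k) :=
    Fin.sum_univ_eq_sum_range (fun k => (sz k : ℝ) * ((∏ i ∈ Finset.range (k + 1), qc i) * p k)) M
  have h := tail_ge_of_le_marg_of_mean (κ := Fin M) M qc hqc (fun k => k.val + 1) (fun k => sz k.val) (fun k => p k.val)
    (fun k => hp k.val) j (fun k _ => k.2) x (fun k hk => hx k.val k.2 hk) (by rw [hsum]; exact hmean)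
  rw [tail_eq_crossing (κ := Fin M) (fun k => k.val) Fin.val_injective M (fun i hi => ⟨⟨i, hi⟩, rfl⟩) (fun k => k.2)
    sz p (fun k => sz k.val) (fun _ => rfl) (fun k => p k.val) (fun _ => rfl) qc j] at h
  exact h

end BlockComb

variable {ι : Type*} [Fintype ι] [DecidableEq ι]

/-- **`Quant.FarTreeRow` holds for EVERY block-comb (unconditional form of `farTree_blockComb_of_staircaseRow`).**  Ancestor finsets `P` of a
rooted forest (`y ∈ P x → P y ⊆ P x`; members of `P x` pairwise comparable), gates `q`, relays `A ∋ a` with `a` least likely, BLOCK-COMB around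
`a` (`P b ≠ P b' → P b ∩ P b' ⊆ P a` on `A`), mean `2j < Σ_{b∈A} ∏_{P b} q`; then `1 − ∏_{P a} q ≤ t` gives `P(#{b ∈ A : ↑(P b) ⊆ ω} ≤ j) ≤ t`.
[this work] -/
theorem farTree_blockComb_comb (P : ι → Finset ι)
    (h2 : ∀ x, ∀ y ∈ P x, P y ⊆ P x) (h3 : ∀ x, ∀ y ∈ P x, ∀ z ∈ P x, y ∈ P z ∨ z ∈ P y)
    (q : ι → unitInterval) (A : Finset ι) (j : ℕ) (t : ℝ) (a : ι) (ha : a ∈ A)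
    (hmin : ∀ b ∈ A, ∏ y ∈ P a, (q y : ℝ) ≤ ∏ y ∈ P b, (q y : ℝ))
    (hcomb : ∀ b ∈ A, ∀ b' ∈ A, P b ≠ P b' → P b ∩ P b' ⊆ P a)
    (hEN : (2 * j : ℝ) < ∑ b ∈ A, ∏ y ∈ P b, (q y : ℝ))
    (ht : 1 - ∏ y ∈ P a, (q y : ℝ) ≤ t) :
    (prodBernoulli q).real {ω : Set ι | (A.filter fun b => ((P b : Finset ι) : Set ι) ⊆ ω).card ≤ j} ≤ t :=
  farTree_blockComb_of_staircaseRow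
    (fun M qc sz p j x hqc hp hx hmean => BlockComb.le_crossing_of_mean M qc sz p j x hqc hp hx hmean)
    P h2 h3 q A j t a ha hmin hcomb hEN ht

/-- **The same on the ESSENTIAL ancestor sets** `{y ∈ P x | q y ≠ 1}` (glued classes as weight-one paths). [this work] -/
theorem farTree_blockComb_comb_essential {m : ℕ} (P : Fin m → Finset (Fin m))
    (h2 : ∀ x, ∀ y ∈ P x, P y ⊆ P x) (h3 : ∀ x, ∀ y ∈ P x, ∀ z ∈ P x, y ∈ P z ∨ z ∈ P y)
    (q : Fin m → unitInterval) (A : Finset (Fin m)) (j : ℕ) (t : ℝ) (a : Fin m) (ha : a ∈ A)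
    (hmin : ∀ b ∈ A, ∏ y ∈ P a, (q y : ℝ) ≤ ∏ y ∈ P b, (q y : ℝ))
    (hcomb : ∀ b ∈ A, ∀ b' ∈ A, (P b).filter (fun y => q y ≠ 1) ≠ (P b').filter (fun y => q y ≠ 1) →
      (P b).filter (fun y => q y ≠ 1) ∩ (P b').filter (fun y => q y ≠ 1) ⊆ (P a).filter (fun y => q y ≠ 1))
    (hEN : (2 * j : ℝ) < ∑ b ∈ A, ∏ y ∈ P b, (q y : ℝ))
    (ht : 1 - ∏ y ∈ P a, (q y : ℝ) ≤ t) :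
    (prodBernoulli q).real {ω : Set (Fin m) | (A.filter fun b => ((P b : Finset (Fin m)) : Set (Fin m)) ⊆ ω).card ≤ j} ≤ t :=
  farTree_blockComb_of_staircaseRow_essential
    (fun M qc sz p j x hqc hp hx hmean => BlockComb.le_crossing_of_mean M qc sz p j x hqc hp hx hmean)
    P h2 h3 q A j t a ha hmin hcomb hEN ht

/-- **Route vocabulary (`o ∉ A`), unconditional form of `farRelayRow_tree_blockComb_of_staircaseRow`**: weights on the pairs of `Fin n` supported
on a rooted spanning tree (`par`/`depth` coordinates; weight `0` prunes); ESSENTIAL ancestor sets `E b`; relays `A ∌ o` with a least likely `a`,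
combed around `a` (`E b ≠ E b' → E b ∩ E b' ⊆ E a` on `A`); then `2j < Σ_{b∈A} P(o ↔ b)` and `P(o ↮ b) ≤ t` on `A` give `P(#{b ∈ A | o ↔ b} ≤ j) ≤ t`
— the body of `Quant.FarRelayRow` for every block-comb. [this work] -/
theorem farRelayRow_tree_blockComb_comb
    (n : ℕ) (w : Sym2 (Fin n) → unitInterval) (o : Fin n)
    (depth : Fin n → ℕ) (par : Fin n → Fin n)
    (hroot : ∀ x, x ≠ o → depth x = 0 → par x = o)
    (hstep : ∀ x, x ≠ o → depth x ≠ 0 → par x ≠ o ∧ depth (par x) + 1 = depth x)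
    (hsupp : ∀ e, w e ≠ 0 → e.IsDiag ∨ ∃ x, x ≠ o ∧ e = s(par x, x))
    (E : Fin n → Finset (Fin n))
    (hE : ∀ b, b ≠ o → E b = ((Finset.range (depth b + 1)).image (fun i => par^[i] b)).filter fun y => w s(par y, y) ≠ 1)
    (A : Finset (Fin n)) (hoA : o ∉ A) (a : Fin n) (ha : a ∈ A)
    (hmin : ∀ b ∈ A, (prodBernoulli w).real (openConn o a) ≤ (prodBernoulli w).real (openConn o b))
    (hcomb : ∀ b ∈ A, ∀ b' ∈ A, E b ≠ E b' → E b ∩ E b' ⊆ E a)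
    (j : ℕ) (hEN : (2 * j : ℝ) < ∑ b ∈ A, (prodBernoulli w).real (openConn o b))
    (t : ℝ) (ht : ∀ b ∈ A, (prodBernoulli w).real (openConn o b : Set (BondConfig (Fin n)))ᶜ ≤ t) :
    (prodBernoulli w).real {ω : BondConfig (Fin n) | (A.filter fun b => ω ∈ openConn o b).card ≤ j} ≤ t :=
  farRelayRow_tree_blockComb_of_staircaseRow
    (fun M qc sz p j x hqc hp hx hmean => BlockComb.le_crossing_of_mean M qc sz p j x hqc hp hx hmean)
    n w o depth par hroot hstep hsupp E hE A hoA a ha hmin hcomb j hEN t ht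

end Quant

end Summit.CriticalPhenomena.PercolationContinuityZ3.Theorems

end
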